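import Mathlib
import HarnessLib
import Summits.Ventures.LatticeQCDFlow.Exactness.LazyRelaxationLagLaw

/-!
# Where to put the relaxation: the lag law with a variable schedule and an exchange rule (lazy layers)

HONEST FRAMING: exact (Metropolis-corrected) sampling algorithms for lattice gauge theory;
figures of merit are autocorrelation/cost numbers at stated couplings and volumes; no
continuum-physics claim.

Venture `LatticeQCDFlow` (cell pub-lqcd), topic `Exactness`, FANOUT row 8 (s0-cpn-nemc, GEN-6).
OUR WORK (elementary finite sums), nothing cited as a fact.  `Exactness/LazyRelaxationLagLaw.lean`
(GEN-5) solved the switching protocol `S_c = S₀ + c • D` with LAZY perfect-relaxation layers of one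
CONSTANT laziness `ε` (`lazyDissipation_eq`: `⟨W⟩ − ΔF = KL_qs + Σ_j (c_{j+1} − c_j) e_j`).  Here
the laziness may vary from slot to slot — `ε_k` for the layer applied right after the switch
`c_k → c_{k+1}` (more sweeps there = smaller `ε_k`) — which is the vocabulary needed to ask WHERE
along the protocol a fixed amount of relaxation should be spent:

* `lagSeqVar ε δ` — the lag with a schedule: `e_0 = 0`, `e_{k+1} = ε_k (e_k + δ_k)`
  (`= lagSeq ε δ` for a constant schedule, `lagSeqVar_const`); `evolveLaw_lazyVar_meanD`
  (`E_{μ_k}[D] = ⟨D⟩_{c_k} + e_k`);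
* `lazyDissipationVar` (`⟨W⟩ − ΔF` with the scheduled layers; `= D(P_F ‖ P_R)` for
  `0 ≤ ε_k < 1`, `kl_path_lazyVar_eq`; `= lazyDissipation` for a constant schedule) and
  **`lazyDissipationVar_eq`**: `⟨W⟩ − ΔF = KL_qs + Σ_{k<n} (c_{k+1} − c_k) e_k` — the lag law holds
  verbatim for any schedule; `qsDissipation_le_lazyDissipationVar`, `lazyDissipationVar_mono`
  (pointwise more laziness ⇒ more dissipation);
* the EXCHANGE of two consecutive slots `j`, `j+1` (schedule `ε'` = `ε` with `ε_j`, `ε_{j+1}`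
  swapped): `lagSeqVar_swap_add_two` (for `k ≥ j+2`,
  `e'_k − e_k = (ε_j − ε_{j+1}) δ_{j+1} Π_{j+2 ≤ i < k} ε_i`) and the exact first variation
  **`sum_lagSeqVar_swap_sub`**:
  `Σ_k w_k e'_k − Σ_k w_k e_k = (ε_{j+1} − ε_j)·[w_{j+1}(e_j + δ_j) − δ_{j+1} Σ_{k ≥ j+2} w_k Π_{j+2≤i<k} ε_i]`;
* **`sum_lagSeqVar_swap_le` / `lazyDissipationVar_swap_le` — RELAX AFTER THE LARGER DROP**: if the
  stronger relaxation sits at slot `j` (`ε_j ≤ ε_{j+1}`) and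
  `(c_{j+2} − c_{j+1})(e_j + δ_j) ≤ (c_{j+3} − c_{j+2}) δ_{j+1}` (uniform grid: the next drop
  `δ_{j+1}` is at least the lag-plus-drop `e_j + δ_j` it would act on now; with no accumulated lag,
  simply `δ_j ≤ δ_{j+1}`), then moving it to slot `j+1` does not increase `⟨W⟩ − ΔF`
  (monotone grid, `ε ≥ 0`, at least one switch after slot `j+1`);
* **`sum_lagSeqVar_swap_ge` / `lazyDissipationVar_swap_ge` — RELAX EARLY WHEN LITTLE DROPS LATER**:
  if instead `δ_{j+1}·(c_n − c_{j+2}) ≤ (c_{j+2} − c_{j+1})(e_j + δ_j)` (the later drop times ALL the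
  remaining switching weight is below the present lag-plus-drop's weight), the stronger relaxation
  is better left at slot `j` (`0 ≤ ε ≤ 1`).

Reading (HOME/s0-cpn-nemc/RESULTS.md §12(d), §13): the typed form of "relaxation is worth most right
AFTER the largest equilibrium drops" (the rule behind `Exactness/LazyRelaxationGranularityWitness`).
Only pairwise exchanges are typed (no global optimum is claimed); nothing here is a claim about the
heat-bath / over-relaxation kernels of the production runs, whose relaxation is not lazy.
-/

namespace Summit.Ventures.LatticeQCDFlow.Exactness

open Finset
open Literature.Probability.MarkovChains (IsRowStochastic)
open Summit.Ventures.LatticeQCDFlow.Theory2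

variable {X : Type*} [Fintype X]

/-! ## The lag with a relaxation schedule -/

/-- The lag of the mean switch observable with a SCHEDULE of lazinesses: `e_0 = 0`,
`e_{k+1} = ε_k (e_k + δ_k)` (`ε_k` = laziness of the layer applied right after the `k`-th switch,
`δ_k` = that switch's equilibrium drop `⟨D⟩_{c_k} − ⟨D⟩_{c_{k+1}}`). -/
def lagSeqVar (ε δ : ℕ → ℝ) : ℕ → ℝ
  | 0 => 0
  | k + 1 => ε k * (lagSeqVar ε δ k + δ k)

/-- `e_0 = 0`. -/
@[simp] theorem lagSeqVar_zero (ε δ : ℕ → ℝ) : lagSeqVar ε δ 0 = 0 := rfl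

/-- `e_{k+1} = ε_k (e_k + δ_k)`. -/
theorem lagSeqVar_succ (ε δ : ℕ → ℝ) (k : ℕ) :
    lagSeqVar ε δ (k + 1) = ε k * (lagSeqVar ε δ k + δ k) := rfl

/-- A constant schedule gives back `lagSeq`. -/
theorem lagSeqVar_const (ε : ℝ) (δ : ℕ → ℝ) : ∀ k, lagSeqVar (fun _ => ε) δ k = lagSeq ε δ k
  | 0 => rfl
  | k + 1 => by rw [lagSeqVar_succ, lagSeq_succ, lagSeqVar_const ε δ k]

/-- `e ≥ 0` for a non-negative schedule and non-negative drops. -/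
theorem lagSeqVar_nonneg {ε δ : ℕ → ℝ} (hε : ∀ k, 0 ≤ ε k) (hδ : ∀ i, 0 ≤ δ i) :
    ∀ k, 0 ≤ lagSeqVar ε δ k
  | 0 => le_rfl
  | k + 1 => mul_nonneg (hε k) (add_nonneg (lagSeqVar_nonneg hε hδ k) (hδ k))

/-- The lag at time `k` depends only on the schedule and the drops before `k`. -/
theorem lagSeqVar_congr {ε ε' δ δ' : ℕ → ℝ} :
    ∀ {k : ℕ}, (∀ i < k, ε i = ε' i) → (∀ i < k, δ i = δ' i) →
      lagSeqVar ε δ k = lagSeqVar ε' δ' k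
  | 0, _, _ => rfl
  | k + 1, hε, hδ => by
      rw [lagSeqVar_succ, lagSeqVar_succ,
        lagSeqVar_congr (fun i hi => hε i (Nat.lt_succ_of_lt hi))
          (fun i hi => hδ i (Nat.lt_succ_of_lt hi)),
        hε k (Nat.lt_succ_self k), hδ k (Nat.lt_succ_self k)]

/-- The lag is monotone in the schedule (pointwise), for non-negative drops. -/
theorem lagSeqVar_mono {ε ε' δ : ℕ → ℝ} (hε : ∀ k, 0 ≤ ε k) (hεε' : ∀ k, ε k ≤ ε' k)
    (hδ : ∀ i, 0 ≤ δ i) : ∀ k, lagSeqVar ε δ k ≤ lagSeqVar ε' δ k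
  | 0 => le_rfl
  | k + 1 => by
      rw [lagSeqVar_succ, lagSeqVar_succ]
      have h1 := lagSeqVar_mono hε hεε' hδ k
      have h2 := lagSeqVar_nonneg hε hδ k
      exact mul_le_mul (hεε' k) (by linarith) (by linarith [hδ k]) ((hε k).trans (hεε' k))

/-! ## The lag law with a schedule -/

section LagLaw

variable [DecidableEq X]

/-- **The mean of the switch observable lags (scheduled layers)**: with the layer of laziness `ε_k`
applied after the `k`-th switch, `E_{μ_k}[D] = ⟨D⟩_{c_k} + e_k`. -/
theorem evolveLaw_lazyVar_meanD [Nonempty X] (S₀ D : X → ℝ) (c : ℕ → ℝ) (ε : ℕ → ℝ) :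
    ∀ j, ∑ y, evolveLaw (fun k => lazyLayer (gibbsLaw (linAction S₀ D (c (k + 1)))) (ε k))
        (gibbsLaw (linAction S₀ D (c 0))) j y * D y
      = meanD S₀ D (c j) + lagSeqVar ε (fun i => meanD S₀ D (c i) - meanD S₀ D (c (i + 1))) j
  | 0 => by simp [meanD, gibbsMean]
  | j + 1 => by
      have ih := evolveLaw_lazyVar_meanD S₀ D c ε j
      have hrow : ∀ k x, ∑ y, lazyLayer (gibbsLaw (linAction S₀ D (c (k + 1)))) (ε k) x y = 1 :=
        fun k x => sum_lazyLayer (sum_gibbsLaw _) (ε k) x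
      have hmass : ∑ y, evolveLaw (fun k => lazyLayer (gibbsLaw (linAction S₀ D (c (k + 1)))) (ε k))
          (gibbsLaw (linAction S₀ D (c 0))) j y = 1 := by
        rw [sum_evolveLaw _ hrow, sum_gibbsLaw]
      rw [evolveLaw_succ]
      simp_rw [stepLaw_lazyLayer _ (ε j) hmass, add_mul, sum_add_distrib, mul_assoc, ← mul_sum, ih]
      simp only [lagSeqVar_succ, meanD, gibbsMean]
      ring

/-- `⟨W⟩ − ΔF` of the `n`-step linear protocol started in equilibrium at `c 0`, with the lazy
perfect-relaxation layer of laziness `ε_k` after the `k`-th switch (`= D(P_F ‖ P_R)` for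
`0 ≤ ε_k < 1`: `kl_path_lazyVar_eq`). -/
noncomputable def lazyDissipationVar (S₀ D : X → ℝ) (c : ℕ → ℝ) (ε : ℕ → ℝ) (n : ℕ) : ℝ :=
  (∑ ω : Fin (n + 1) → X,
      pathLaw (gibbsLaw (linAction S₀ D (c 0)))
        (fun k : Fin n => lazyLayer (gibbsLaw (linAction S₀ D (c (k + 1)))) (ε k)) ω
      * work (fun k : Fin (n + 1) => linAction S₀ D (c k)) ω)
    - (linFreeEnergy S₀ D (c n) - linFreeEnergy S₀ D (c 0))

/-- A constant schedule gives back `lazyDissipation`. -/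
theorem lazyDissipationVar_const (S₀ D : X → ℝ) (c : ℕ → ℝ) (ε : ℝ) (n : ℕ) :
    lazyDissipationVar S₀ D c (fun _ => ε) n = lazyDissipation S₀ D c ε n := rfl

/-- The mean work with scheduled layers: `⟨W⟩ = Σ_k (c_{k+1} − c_k)(⟨D⟩_{c_k} + e_k)`. -/
theorem meanWork_lazyVar_eq [Nonempty X] (S₀ D : X → ℝ) (c : ℕ → ℝ) (ε : ℕ → ℝ) (n : ℕ) :
    ∑ ω : Fin (n + 1) → X,
        pathLaw (gibbsLaw (linAction S₀ D (c 0)))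
          (fun k : Fin n => lazyLayer (gibbsLaw (linAction S₀ D (c (k + 1)))) (ε k)) ω
        * work (fun k : Fin (n + 1) => linAction S₀ D (c k)) ω
      = ∑ j ∈ range n, (c (j + 1) - c j) *
          (meanD S₀ D (c j)
            + lagSeqVar ε (fun i => meanD S₀ D (c i) - meanD S₀ D (c (i + 1))) j) := by
  have hrow : ∀ k x, ∑ y, lazyLayer (gibbsLaw (linAction S₀ D (c (k + 1)))) (ε k) x y = 1 :=
    fun k x => sum_lazyLayer (sum_gibbsLaw _) (ε k) x
  have h := meanWork_eq_sum_evolveLaw n (gibbsLaw (linAction S₀ D (c 0)))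
    (fun k => linAction S₀ D (c k))
    (fun k => lazyLayer (gibbsLaw (linAction S₀ D (c (k + 1)))) (ε k)) hrow
  beta_reduce at h
  rw [h]
  refine sum_congr rfl fun j _ => ?_
  rw [← evolveLaw_lazyVar_meanD S₀ D c ε j, mul_sum]
  refine sum_congr rfl fun y _ => ?_
  simp only [linAction]
  ring

/-- **The lag law with a schedule (exact).**  `⟨W⟩ − ΔF = KL_qs + Σ_{k<n} (c_{k+1} − c_k) e_k` for
any grid and any schedule of lazinesses. -/
theorem lazyDissipationVar_eq [Nonempty X] (S₀ D : X → ℝ) (c : ℕ → ℝ) (ε : ℕ → ℝ) (n : ℕ) :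
    lazyDissipationVar S₀ D c ε n
      = qsDissipation S₀ D c n
        + ∑ j ∈ range n, (c (j + 1) - c j)
            * lagSeqVar ε (fun i => meanD S₀ D (c i) - meanD S₀ D (c (i + 1))) j := by
  have tel : ∑ j ∈ range n, (linFreeEnergy S₀ D (c (j + 1)) - linFreeEnergy S₀ D (c j))
      = linFreeEnergy S₀ D (c n) - linFreeEnergy S₀ D (c 0) :=
    Finset.sum_range_sub (fun j => linFreeEnergy S₀ D (c j)) n
  unfold lazyDissipationVar qsDissipation
  rw [meanWork_lazyVar_eq, ← tel, ← sum_sub_distrib, ← sum_add_distrib]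
  exact sum_congr rfl fun j _ => by ring

/-- For `0 ≤ ε_k < 1` the scheduled layers are positive and stochastic, and `lazyDissipationVar` IS
`D(P_F ‖ P_R)` of the protocol (the printed `D̃_KL`). -/
theorem kl_path_lazyVar_eq [Nonempty X] (S₀ D : X → ℝ) (c : ℕ → ℝ) {ε : ℕ → ℝ}
    (h0 : ∀ k, 0 ≤ ε k) (h1 : ∀ k, ε k < 1) (n : ℕ) :
    klFin (pathLaw (gibbsLaw (linAction S₀ D (c 0)))
            (fun k : Fin n => lazyLayer (gibbsLaw (linAction S₀ D (c (k + 1)))) (ε k)))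
        (revPathLaw (fun k : Fin (n + 1) => linAction S₀ D (c k))
            (fun k : Fin n => lazyLayer (gibbsLaw (linAction S₀ D (c (k + 1)))) (ε k)))
      = lazyDissipationVar S₀ D c ε n := by
  have hP : ∀ k : Fin n,
      IsRowStochastic (lazyLayer (gibbsLaw (linAction S₀ D (c (k + 1)))) (ε k)) :=
    fun k => isRowStochastic_lazyLayer (fun y => (gibbsLaw_pos _ y).le) (sum_gibbsLaw _)
      (h0 k) (h1 k).le
  have hPpos : ∀ (k : Fin n) (x y : X),
      0 < lazyLayer (gibbsLaw (linAction S₀ D (c (k + 1)))) (ε k) x y :=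
    fun k x y => lazyLayer_pos (gibbsLaw_pos _) (h0 k) (h1 k) x y
  have h := kl_path_eq_dissipation (fun k : Fin (n + 1) => linAction S₀ D (c k))
    (fun k : Fin n => lazyLayer (gibbsLaw (linAction S₀ D (c (k + 1)))) (ε k)) hP hPpos
  simp only [Fin.val_zero, Fin.val_last] at h
  rw [h]
  unfold lazyDissipationVar linFreeEnergy freeEnergy
  rw [Real.log_div (partitionFn_pos _).ne' (partitionFn_pos _).ne']
  ring

/-- Under-relaxation costs, for any schedule: `KL_qs ≤ ⟨W⟩ − ΔF` along a monotone grid, `ε ≥ 0`. -/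
theorem qsDissipation_le_lazyDissipationVar [Nonempty X] (S₀ D : X → ℝ) {c : ℕ → ℝ}
    (hc : Monotone c) {ε : ℕ → ℝ} (hε : ∀ k, 0 ≤ ε k) (n : ℕ) :
    qsDissipation S₀ D c n ≤ lazyDissipationVar S₀ D c ε n := by
  rw [lazyDissipationVar_eq]
  have hδ : ∀ i, 0 ≤ meanD S₀ D (c i) - meanD S₀ D (c (i + 1)) :=
    fun i => sub_nonneg.mpr (meanD_antitone S₀ D (hc (Nat.le_succ i)))
  exact le_add_of_nonneg_right (sum_nonneg fun j _ =>
    mul_nonneg (sub_nonneg.mpr (hc (Nat.le_succ j))) (lagSeqVar_nonneg hε hδ j))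

/-- Pointwise more laziness, more dissipation (monotone grid). -/
theorem lazyDissipationVar_mono [Nonempty X] (S₀ D : X → ℝ) {c : ℕ → ℝ} (hc : Monotone c)
    {ε ε' : ℕ → ℝ} (hε : ∀ k, 0 ≤ ε k) (hεε' : ∀ k, ε k ≤ ε' k) (n : ℕ) :
    lazyDissipationVar S₀ D c ε n ≤ lazyDissipationVar S₀ D c ε' n := by
  rw [lazyDissipationVar_eq, lazyDissipationVar_eq]
  have hδ : ∀ i, 0 ≤ meanD S₀ D (c i) - meanD S₀ D (c (i + 1)) :=
    fun i => sub_nonneg.mpr (meanD_antitone S₀ D (hc (Nat.le_succ i)))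
  have h : ∑ j ∈ range n, (c (j + 1) - c j)
        * lagSeqVar ε (fun i => meanD S₀ D (c i) - meanD S₀ D (c (i + 1))) j
      ≤ ∑ j ∈ range n, (c (j + 1) - c j)
        * lagSeqVar ε' (fun i => meanD S₀ D (c i) - meanD S₀ D (c (i + 1))) j :=
    sum_le_sum fun j _ =>
      mul_le_mul_of_nonneg_left (lagSeqVar_mono hε hεε' hδ j) (sub_nonneg.mpr (hc (Nat.le_succ j)))
  linarith

end LagLaw

/-! ## Exchanging two consecutive relaxation slots -/

section Exchange

variable {ε ε' δ : ℕ → ℝ} {j : ℕ}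

/-- Before the exchanged slots the lags agree (`k ≤ j`). -/
theorem lagSeqVar_swap_eq_of_le (hsw : ∀ k, k ≠ j → k ≠ j + 1 → ε' k = ε k) :
    ∀ k ≤ j, lagSeqVar ε' δ k = lagSeqVar ε δ k :=
  fun _ hk => lagSeqVar_congr (fun i hi => hsw i (by omega) (by omega)) (fun _ _ => rfl)

/-- Right after the first exchanged slot: `e'_{j+1} = ε_{j+1} (e_j + δ_j)`. -/
theorem lagSeqVar_swap_succ (hj : ε' j = ε (j + 1))
    (hsw : ∀ k, k ≠ j → k ≠ j + 1 → ε' k = ε k) :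
    lagSeqVar ε' δ (j + 1) = ε (j + 1) * (lagSeqVar ε δ j + δ j) := by
  rw [lagSeqVar_succ, hj, lagSeqVar_swap_eq_of_le hsw j le_rfl]

/-- After both exchanged slots the difference propagates geometrically:
`e'_{j+2+m} − e_{j+2+m} = (ε_j − ε_{j+1}) δ_{j+1} Π_{i<m} ε_{j+2+i}`. -/
theorem lagSeqVar_swap_add_two (hj : ε' j = ε (j + 1)) (hj1 : ε' (j + 1) = ε j)
    (hsw : ∀ k, k ≠ j → k ≠ j + 1 → ε' k = ε k) :
    ∀ m, lagSeqVar ε' δ (j + 2 + m) - lagSeqVar ε δ (j + 2 + m)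
      = (ε j - ε (j + 1)) * δ (j + 1) * ∏ i ∈ range m, ε (j + 2 + i)
  | 0 => by
      rw [add_zero, prod_range_zero, mul_one, show j + 2 = j + 1 + 1 from rfl, lagSeqVar_succ,
        lagSeqVar_succ ε δ (j + 1), hj1, lagSeqVar_swap_succ hj hsw, lagSeqVar_succ]
      ring
  | m + 1 => by
      have ih := lagSeqVar_swap_add_two hj hj1 hsw m
      rw [← add_assoc, lagSeqVar_succ, lagSeqVar_succ, hsw (j + 2 + m) (by omega) (by omega),
        prod_range_succ, ← mul_sub, add_sub_add_right_eq_sub, ih]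
      ring

/-- **Exact first variation under the exchange.**  With weights `w_k` (the switching increments
`c_{k+1} − c_k`), over the horizon `j + 2 + t`:
`Σ_k w_k e'_k − Σ_k w_k e_k = (ε_{j+1} − ε_j)·[w_{j+1}(e_j + δ_j) − δ_{j+1} Σ_{m<t} w_{j+2+m} Π_{i<m} ε_{j+2+i}]`. -/
theorem sum_lagSeqVar_swap_sub (w : ℕ → ℝ) (hj : ε' j = ε (j + 1)) (hj1 : ε' (j + 1) = ε j)
    (hsw : ∀ k, k ≠ j → k ≠ j + 1 → ε' k = ε k) (t : ℕ) :
    ∑ k ∈ range (j + 2 + t), w k * lagSeqVar ε' δ k - ∑ k ∈ range (j + 2 + t), w k * lagSeqVar ε δ k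
      = (ε (j + 1) - ε j) * (w (j + 1) * (lagSeqVar ε δ j + δ j)
          - δ (j + 1) * ∑ m ∈ range t, w (j + 2 + m) * ∏ i ∈ range m, ε (j + 2 + i)) := by
  have h0 : ∑ k ∈ range j, (w k * lagSeqVar ε' δ k - w k * lagSeqVar ε δ k) = 0 :=
    sum_eq_zero fun k hk => by
      rw [lagSeqVar_swap_eq_of_le hsw k (mem_range.mp hk).le, sub_self]
  have h1 : w j * lagSeqVar ε' δ j - w j * lagSeqVar ε δ j = 0 := by
    rw [lagSeqVar_swap_eq_of_le hsw j le_rfl, sub_self]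
  have h2 : w (j + 1) * lagSeqVar ε' δ (j + 1) - w (j + 1) * lagSeqVar ε δ (j + 1)
      = (ε (j + 1) - ε j) * (w (j + 1) * (lagSeqVar ε δ j + δ j)) := by
    rw [lagSeqVar_swap_succ hj hsw, lagSeqVar_succ]
    ring
  have h3 : ∑ m ∈ range t, (w (j + 2 + m) * lagSeqVar ε' δ (j + 2 + m)
        - w (j + 2 + m) * lagSeqVar ε δ (j + 2 + m))
      = (ε j - ε (j + 1)) * δ (j + 1)
          * ∑ m ∈ range t, w (j + 2 + m) * ∏ i ∈ range m, ε (j + 2 + i) := by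
    rw [mul_sum]
    refine sum_congr rfl fun m _ => ?_
    rw [← mul_sub, lagSeqVar_swap_add_two hj hj1 hsw m]
    ring
  rw [← sum_sub_distrib, sum_range_add, sum_range_succ, sum_range_succ, h0, h1, h2, h3]
  ring

/-- **Exchange rule — relax after the larger drop.**  Non-negative weights, schedule and drops; the
stronger relaxation sits at slot `j` (`ε_j ≤ ε_{j+1}`); at least one weighted slot after `j+1`
(horizon `j + 3 + t`).  If `w_{j+1}(e_j + δ_j) ≤ w_{j+2} δ_{j+1}`, exchanging the two slots (stronger
relaxation AFTER the drop `δ_{j+1}`) does not increase the weighted lag. -/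
theorem sum_lagSeqVar_swap_le (w : ℕ → ℝ) (hw : ∀ k, 0 ≤ w k) (hε : ∀ k, 0 ≤ ε k)
    (hδ : ∀ i, 0 ≤ δ i) (hj : ε' j = ε (j + 1)) (hj1 : ε' (j + 1) = ε j)
    (hsw : ∀ k, k ≠ j → k ≠ j + 1 → ε' k = ε k) (hjj : ε j ≤ ε (j + 1)) (t : ℕ)
    (hdrop : w (j + 1) * (lagSeqVar ε δ j + δ j) ≤ w (j + 2) * δ (j + 1)) :
    ∑ k ∈ range (j + 3 + t), w k * lagSeqVar ε' δ k
      ≤ ∑ k ∈ range (j + 3 + t), w k * lagSeqVar ε δ k := by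
  rw [show j + 3 + t = j + 2 + (t + 1) by ring, ← sub_nonpos,
    sum_lagSeqVar_swap_sub w hj hj1 hsw (t + 1)]
  have hS : w (j + 2) ≤ ∑ m ∈ range (t + 1), w (j + 2 + m) * ∏ i ∈ range m, ε (j + 2 + i) := by
    rw [sum_range_succ']
    simp only [add_zero, prod_range_zero, mul_one]
    exact le_add_of_nonneg_left (sum_nonneg fun m _ =>
      mul_nonneg (hw _) (prod_nonneg fun i _ => hε _))
  have hb : w (j + 1) * (lagSeqVar ε δ j + δ j)
      - δ (j + 1) * ∑ m ∈ range (t + 1), w (j + 2 + m) * ∏ i ∈ range m, ε (j + 2 + i) ≤ 0 := by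
    have := mul_le_mul_of_nonneg_left hS (hδ (j + 1))
    linarith
  exact mul_nonpos_iff.mpr (Or.inl ⟨sub_nonneg.mpr hjj, hb⟩)

/-- **Mirror rule — relax early when little drops later.**  Same setting with `ε ≤ 1`: if
`δ_{j+1} Σ_{m<t} w_{j+2+m} ≤ w_{j+1}(e_j + δ_j)` (the later drop times all the remaining weight is
below the weight of the lag-plus-drop present now), the stronger relaxation is better left at slot
`j`. -/
theorem sum_lagSeqVar_swap_ge (w : ℕ → ℝ) (hw : ∀ k, 0 ≤ w k) (hε : ∀ k, 0 ≤ ε k)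
    (hε1 : ∀ k, ε k ≤ 1) (hδ : ∀ i, 0 ≤ δ i) (hj : ε' j = ε (j + 1)) (hj1 : ε' (j + 1) = ε j)
    (hsw : ∀ k, k ≠ j → k ≠ j + 1 → ε' k = ε k) (hjj : ε j ≤ ε (j + 1)) (t : ℕ)
    (hsmall : δ (j + 1) * ∑ m ∈ range t, w (j + 2 + m) ≤ w (j + 1) * (lagSeqVar ε δ j + δ j)) :
    ∑ k ∈ range (j + 2 + t), w k * lagSeqVar ε δ k
      ≤ ∑ k ∈ range (j + 2 + t), w k * lagSeqVar ε' δ k := by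
  rw [← sub_nonneg, sum_lagSeqVar_swap_sub w hj hj1 hsw t]
  have hS : ∑ m ∈ range t, w (j + 2 + m) * ∏ i ∈ range m, ε (j + 2 + i)
      ≤ ∑ m ∈ range t, w (j + 2 + m) :=
    sum_le_sum fun m _ => by
      have hp : ∏ i ∈ range m, ε (j + 2 + i) ≤ 1 :=
        prod_le_one (fun i _ => hε _) (fun i _ => hε1 _)
      have := mul_le_mul_of_nonneg_left hp (hw (j + 2 + m))
      linarith
  have hb := mul_le_mul_of_nonneg_left hS (hδ (j + 1))
  exact mul_nonneg (sub_nonneg.mpr hjj) (by linarith)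

end Exchange

/-! ## The exchange rules for the dissipation -/

section ExchangeDissipation

variable [DecidableEq X]

/-- **Relax after the larger drop (dissipation form).**  Monotone grid, non-negative schedule with
the stronger relaxation at slot `j` (`ε_j ≤ ε_{j+1}`), `ε'` = the schedule with slots `j`, `j+1`
exchanged, horizon `n = j + 3 + t`.  If
`(c_{j+2} − c_{j+1})·(e_j + δ_j) ≤ (c_{j+3} − c_{j+2})·δ_{j+1}` (`e_j` = the lag present before slot
`j`, `δ_k = ⟨D⟩_{c_k} − ⟨D⟩_{c_{k+1}}`), then `⟨W⟩ − ΔF [ε'] ≤ ⟨W⟩ − ΔF [ε]`. -/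
theorem lazyDissipationVar_swap_le [Nonempty X] (S₀ D : X → ℝ) {c : ℕ → ℝ} (hc : Monotone c)
    {ε ε' : ℕ → ℝ} (hε : ∀ k, 0 ≤ ε k) {j : ℕ} (hj : ε' j = ε (j + 1)) (hj1 : ε' (j + 1) = ε j)
    (hsw : ∀ k, k ≠ j → k ≠ j + 1 → ε' k = ε k) (hjj : ε j ≤ ε (j + 1)) (t : ℕ)
    (hdrop : (c (j + 2) - c (j + 1))
        * (lagSeqVar ε (fun i => meanD S₀ D (c i) - meanD S₀ D (c (i + 1))) j
            + (meanD S₀ D (c j) - meanD S₀ D (c (j + 1))))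
      ≤ (c (j + 3) - c (j + 2)) * (meanD S₀ D (c (j + 1)) - meanD S₀ D (c (j + 2)))) :
    lazyDissipationVar S₀ D c ε' (j + 3 + t) ≤ lazyDissipationVar S₀ D c ε (j + 3 + t) := by
  rw [lazyDissipationVar_eq, lazyDissipationVar_eq]
  have hδ : ∀ i, 0 ≤ meanD S₀ D (c i) - meanD S₀ D (c (i + 1)) :=
    fun i => sub_nonneg.mpr (meanD_antitone S₀ D (hc (Nat.le_succ i)))
  have hw : ∀ k, 0 ≤ c (k + 1) - c k := fun k => sub_nonneg.mpr (hc (Nat.le_succ k))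
  have h := sum_lagSeqVar_swap_le (fun k => c (k + 1) - c k) hw hε hδ hj hj1 hsw hjj t hdrop
  linarith

/-- **Relax early when little drops later (dissipation form).**  Same setting with `ε ≤ 1`,
horizon `n = j + 2 + t`: if `δ_{j+1}·(c_n − c_{j+2}) ≤ (c_{j+2} − c_{j+1})·(e_j + δ_j)`, then
`⟨W⟩ − ΔF [ε] ≤ ⟨W⟩ − ΔF [ε']`. -/
theorem lazyDissipationVar_swap_ge [Nonempty X] (S₀ D : X → ℝ) {c : ℕ → ℝ} (hc : Monotone c)
    {ε ε' : ℕ → ℝ} (hε : ∀ k, 0 ≤ ε k) (hε1 : ∀ k, ε k ≤ 1) {j : ℕ} (hj : ε' j = ε (j + 1))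
    (hj1 : ε' (j + 1) = ε j) (hsw : ∀ k, k ≠ j → k ≠ j + 1 → ε' k = ε k)
    (hjj : ε j ≤ ε (j + 1)) (t : ℕ)
    (hsmall : (meanD S₀ D (c (j + 1)) - meanD S₀ D (c (j + 2))) * (c (j + 2 + t) - c (j + 2))
      ≤ (c (j + 2) - c (j + 1))
        * (lagSeqVar ε (fun i => meanD S₀ D (c i) - meanD S₀ D (c (i + 1))) j
            + (meanD S₀ D (c j) - meanD S₀ D (c (j + 1))))) :
    lazyDissipationVar S₀ D c ε (j + 2 + t) ≤ lazyDissipationVar S₀ D c ε' (j + 2 + t) := by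
  rw [lazyDissipationVar_eq, lazyDissipationVar_eq]
  have hδ : ∀ i, 0 ≤ meanD S₀ D (c i) - meanD S₀ D (c (i + 1)) :=
    fun i => sub_nonneg.mpr (meanD_antitone S₀ D (hc (Nat.le_succ i)))
  have hw : ∀ k, 0 ≤ c (k + 1) - c k := fun k => sub_nonneg.mpr (hc (Nat.le_succ k))
  have tel : ∑ m ∈ range t, (c (j + 2 + m + 1) - c (j + 2 + m)) = c (j + 2 + t) - c (j + 2) := by
    have h := Finset.sum_range_sub (fun m => c (j + 2 + m)) t
    simpa [add_assoc] using h
  have hsmall' : (meanD S₀ D (c (j + 1)) - meanD S₀ D (c (j + 2)))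
        * ∑ m ∈ range t, (c (j + 2 + m + 1) - c (j + 2 + m))
      ≤ (c (j + 2) - c (j + 1))
        * (lagSeqVar ε (fun i => meanD S₀ D (c i) - meanD S₀ D (c (i + 1))) j
            + (meanD S₀ D (c j) - meanD S₀ D (c (j + 1)))) := by
    rw [tel]
    exact hsmall
  have h := sum_lagSeqVar_swap_ge (fun k => c (k + 1) - c k) hw hε hε1 hδ hj hj1 hsw hjj t hsmall'
  linarith

end ExchangeDissipation

end Summit.Ventures.LatticeQCDFlow.Exactness
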